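import Summits.ResolutionOfSingularities.ResolutionOfSingularities.Theorems.WildConesCampaignW46ForcedAtomPermissible
import Summits.ResolutionOfSingularities.ResolutionOfSingularities.Theorems.WildConesCampaignW46AtomChartZResidue
import Summits.ResolutionOfSingularities.ResolutionOfSingularities.Theorems.WildConesCampaignW46ChartPointInjective
import HarnessLib

/-!
# [OURS · L1 W4.6, rung (i) — the dictionary, SCHEME HALF, brick 30] The CANONICAL CHART DATUM of a singular point of
# the transform over a forced-atom point: smallest `u`-chart, `u`-residues, vanishing `z`-residue, successor atom

Cell res-hironaka (LADDER-RESOLUTION rung L, D-0089), slot W4.6 «restricted regimes as rungs», seat res-L1-s46-pv-2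
(gen 5: the GEOMETRIC upgrade of the forced-atom rung — finitely many singular points instead of one). Host: route
`WildCones`, crux `ClassicalRegimes` (stmt-ResolutionOfSingularities-16884), `--supports … --as helper`.

HONEST FRAMING. Everything here is OURS: this seat's one-step dictionary (gen 3, `ForcedAtom.exists_presentation_
transform_of_isBlowup`, p523688) re-run with the centre read as `π ξ′ = ξ` instead of «`Sing(E)` is a subsingleton»,
with a FIXED adapted system of parameters `c` at `ξ` (shared by all points over `ξ`), the chart index made CANONICAL
(the smallest `u`-chart containing the point, brick 10 `FormalChart.exists_chartData_reindex`), and the `z`-residue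
recorded (brick 28 `AtomGerm.tau_none_mem_maximalIdeal_of_transform_mem`). NOTHING here is a statement of
H. Hironaka's manuscript [Hironaka2017] and nothing of it is used; no FACT-LIST premise. AI review is weaker than
expert review.

## What is proved (`ForcedAtom.exists_canonical_chartDatum`, and `…_of_eq` with the base point named)

`K` algebraically closed of characteristic `p`; `π : Z′ → Z` the blow-up of an ambient datum along the reduced ideal of
`D = {ξ}` over the same base field; `E = (J, p)`; at `ξ`: embedding dimension `n + 1`, a presentation
`E₀ : 𝒪̂_{Z,ξ} ≅ K⟦z,u⟧`, `J_ξ = (f₀)`, `E₀ f₀ = w · (z^p − ser a)` with `MultP a` and `ser a ∈ 𝔪^(p+1)` (order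
`≥ p + 1`), and an adapted system `c` (`(c) = 𝔪_ξ`, `E₀ c_j ≡ X_j mod 𝔪²`). Then every CLOSED point `ξ′ ∈ Sing(E′)` of
the transform with `π ξ′ = ξ` carries: a chart index `i₀ : Fin n`, quotients `e_j ∈ 𝒪_{Z′,ξ′}` with
`g c_j = g c_{i₀} · e_j` (`g` the structure map `𝒪_{Z,ξ} → 𝒪_{Z′,ξ′}`), lifts `τ̃_j ∈ 𝒪_{Z,ξ}` with
`e_j − g τ̃_j ∈ 𝔪_{ξ′}` (`j ≠ i₀`), such that **`τ̃_none ∈ 𝔪_ξ`** (the point lies on `z′ = 0`), **`τ̃_l ∈ 𝔪_ξ` for all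
`l < i₀`** (the chart is the smallest one containing the point), and a presentation of `J′_{ξ′}` by a unit times the
SUCCESSOR atom `z^p − ser (step i₀ t a)` with `t_l =` the residue of `τ̃_l`. With brick 27 this datum DETERMINES the
point; with brick 29 (surfaces) at most three such data have a forced successor.

References: this seat's bricks 4–13, 27, 28; H. Matsumura, *Commutative Ring Theory* (1986), Thm. 8.11
[Matsumura1987]; H. Hironaka, ms. 2017, Def. 2.1 p.5 / Th. 16.6 p.84 — ROLE of «the transform `E′` at the closed
points over the centre» only, under adjudication, not cited as fact. [folklore]
-/

noncomputable section

-- single-problem summit: the doubled namespace component `ResolutionOfSingularities` is forced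
set_option linter.dupNamespace false

open scoped BigOperators Classical
open MvPowerSeries IsLocalRing

namespace Summit.ResolutionOfSingularities.ResolutionOfSingularities.Theorems

namespace CampaignW46.ForcedAtom

open CategoryTheory AlgebraicGeometry TopologicalSpace
open Literature.AlgebraicGeometry.Resolution
open Literature.AlgebraicGeometry.Hironaka2017.S02Preliminaries
open Literature.AlgebraicGeometry.Hironaka2017.Datum
open Scheme.IdealSheafData
open WildCones
open CampaignW46.ChartPoint CampaignW46.AtomGerm CampaignW46.FormalChart

variable {p : ℕ} [Fact p.Prime] {K : Type} [Field K] [CharP K p] [IsAlgClosed K] {n : ℕ}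

/-! ## The canonical chart datum (base point `π ξ′`) -/

/-- [OURS · L1 W4.6 — DICTIONARY, canonical chart datum of a singular point of the transform over a forced-atom point;
replaces the role of «the transform `E′` of `E` by the blowup with center `D`» (H. Hironaka, ms. 2017, Def. 2.1 p.5)
at the closed points over an isolated `p`-fold point presented by a height-one atom of order `≥ p + 1`; NOT a
statement of the manuscript] See the module docstring; here the base point is `π ξ′` and `g = π^♯_{ξ′}`. [folklore] -/
theorem exists_canonical_chartDatum {A A' : AmbientDatum p K} (π : A'.Z ⟶ A.Z) (D : Closeds A.Z)
    (hπ : IsBlowup π (vanishingIdeal D)) (hhom : A'.hom = π ≫ A.hom) {E : IdealExponent A.Z} (hb : E.b = p)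
    {ξ' : A'.Z} (hD : (D : Set A.Z) = {π ξ'})
    (hd : (maximalIdeal (A.Z.presheaf.stalk (π ξ'))).spanFinrank = n + 1)
    (E₀ : AdicCompletion (maximalIdeal (A.Z.presheaf.stalk (π ξ'))) (A.Z.presheaf.stalk (π ξ')) ≃+*
      MvPowerSeries (Option (Fin n)) K)
    (c : Option (Fin n) → A.Z.presheaf.stalk (π ξ'))
    (hc : Ideal.span (Set.range c) = maximalIdeal (A.Z.presheaf.stalk (π ξ')))
    (hcX : ∀ j, E₀ (algebraMap _ _ (c j)) - X j ∈ maximalIdeal (MvPowerSeries (Option (Fin n)) K) ^ 2)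
    (f₀ : A.Z.presheaf.stalk (π ξ')) (a : (Fin n → ℕ) → K) (w : MvPowerSeries (Option (Fin n)) K)
    (hJ : stalkIdeal E.J (π ξ') = Ideal.span {f₀}) (hw : IsUnit w)
    (hf₀ : E₀ (algebraMap _ _ f₀) =
      w * ((X none : MvPowerSeries (Option (Fin n)) K) ^ p - rename (some : Fin n → Option (Fin n)) (ser p n K a)))
    (hM : MultP p n K a) (hord : ser p n K a ∈ maximalIdeal (MvPowerSeries (Fin n) K) ^ (p + 1))
    (hξ' : ξ' ∈ (E.transform π D).sing) (hξ'cl : IsClosed ({ξ'} : Set A'.Z)) :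
    ∃ (i₀ : Fin n) (e : Option (Fin n) → A'.Z.presheaf.stalk ξ') (τ : Option (Fin n) → A.Z.presheaf.stalk (π ξ'))
      (E₀' : AdicCompletion (maximalIdeal (A'.Z.presheaf.stalk ξ')) (A'.Z.presheaf.stalk ξ') ≃+*
        MvPowerSeries (Option (Fin n)) K)
      (f₀' : A'.Z.presheaf.stalk ξ') (w' : MvPowerSeries (Option (Fin n)) K),
      (∀ j, (π.stalkMap ξ').hom (c j) = (π.stalkMap ξ').hom (c (some i₀)) * e j) ∧
      (∀ j, j ≠ some i₀ → e j - (π.stalkMap ξ').hom (τ j) ∈ maximalIdeal (A'.Z.presheaf.stalk ξ')) ∧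
      τ none ∈ maximalIdeal (A.Z.presheaf.stalk (π ξ')) ∧
      (∀ l : Fin n, l < i₀ → τ (some l) ∈ maximalIdeal (A.Z.presheaf.stalk (π ξ'))) ∧
      stalkIdeal (E.transform π D).J ξ' = Ideal.span {f₀'} ∧ IsUnit w' ∧
        E₀' (algebraMap _ _ f₀') =
          w' * ((X none : MvPowerSeries (Option (Fin n)) K) ^ p -
            rename (some : Fin n → Option (Fin n))
              (ser p n K (step p n K i₀ (fun l => constantCoeff (E₀ (algebraMap _ _ (τ (some l))))) a))) := by
  haveI : IsLocallyNoetherian A'.Z := ambient_isLocallyNoetherian A'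
  have hp : p.Prime := Fact.out
  haveI : IsRegularLocalRing (A.Z.presheaf.stalk (π ξ')) := ambient_isRegular A _
  haveI : IsRegularLocalRing (A'.Z.presheaf.stalk ξ') := ambient_isRegular A' _
  -- the local homomorphism `(π.stalkMap ξ').hom = π^♯_{ξ′}`
  have hloc : IsLocalHom (π.stalkMap ξ').hom := inferInstance
  have hg : (maximalIdeal (A.Z.presheaf.stalk (π ξ'))).map (π.stalkMap ξ').hom ≤
      maximalIdeal (A'.Z.presheaf.stalk ξ') :=
    ((IsLocalRing.local_hom_TFAE (π.stalkMap ξ').hom).out 0 2).mp hloc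
  have hcl : IsClosed ({π ξ'} : Set A.Z) := hD ▸ D.isClosed
  have hcJ : Ideal.span (Set.range c) = stalkIdeal (vanishingIdeal D) (π ξ') := by
    rw [hc, stalkIdeal_vanishingIdeal_eq_maximalIdeal_of_closure_eq]
    rw [hD, hcl.closure_eq]
  -- `ξ′` is rational relative to `π`
  haveI : LocallyOfFiniteType (π ≫ A.hom) := by
    rw [← hhom]
    haveI := A'.smooth
    infer_instance
  have hrat : ∀ y : A'.Z.presheaf.stalk ξ', ∃ r : A.Z.presheaf.stalk (π ξ'),
      y - (π.stalkMap ξ').hom r ∈ maximalIdeal (A'.Z.presheaf.stalk ξ') := fun y =>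
    exists_sub_stalkMap_mem_maximalIdeal_of_isClosed π A.hom ξ' hξ'cl y
  -- chart data of the blow-up at `ξ′`, some index `i`
  have hd' : (maximalIdeal (A.Z.presheaf.stalk (π ξ'))).spanFinrank = Fintype.card (Option (Fin n)) := by
    rw [hd, Fintype.card_option, Fintype.card_fin]
  obtain ⟨i, e, τ, he, hei, hnzd, hgen, -, hdim⟩ := exists_stalk_chartData_nzd hπ ξ' c hcJ hc hd' hrat
  -- `f₀ ∈ 𝔪^p` (the atom has order `≥ p`)
  have hf₀𝔪 : f₀ ∈ maximalIdeal (A.Z.presheaf.stalk (π ξ')) ^ p := by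
    rw [mem_maximalIdeal_pow_iff_of_ringEquiv E₀ hw hf₀ p, atom_mem_maximalIdeal_pow_iff]
    exact Ideal.pow_le_pow_right (Nat.le_succ p) hord
  -- the set of `u`-charts containing the point: `l` with `e_l` a unit (or `i` itself)
  set U : Finset (Fin n) := Finset.univ.filter (fun l => IsUnit (e (some l))) with hU
  -- `U` is non-empty: if `i = some i'` then `i' ∈ U`; if `i = none` the `z`-chart point is not on the transform
  have hUne : U.Nonempty := by
    cases hi : i with
    | some i' =>
      refine ⟨i', Finset.mem_filter.mpr ⟨Finset.mem_univ _, ?_⟩⟩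
      rw [hi] at hei
      rw [hei]; exact isUnit_one
    | none =>
      rw [hi] at he hei hnzd hgen
      obtain ⟨f', hf'⟩ := exists_eq_pow_mul_of_mem_pow (π.stalkMap ξ').hom c hc none e he hf₀𝔪
      have hJ' : stalkIdeal (E.transform π D).J ξ' = Ideal.span {f'} :=
        stalkIdeal_transform_eq_span hπ ξ' c hcJ none e he hnzd E f₀ hJ f' (by rw [hb]; exact hf')
      have hf'𝔪 : f' ∈ maximalIdeal (A'.Z.presheaf.stalk ξ') := by
        have h := (mem_sing_transform_iff E ξ' f' hJ').mp hξ'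
        rw [hb] at h
        exact Ideal.pow_le_self hp.ne_zero h
      by_contra hU0
      rw [Finset.not_nonempty_iff_eq_empty, Finset.filter_eq_empty_iff] at hU0
      refine absurd hf'𝔪 (not_mem_maximalIdeal_transform_of_zChart (π.stalkMap ξ').hom hg E₀ c hc hcX e he τ hgen
        hrat hdim (fun j => ?_) a hM f₀ w hw hf₀ f' hf')
      -- `τ_j ∈ 𝔪`: otherwise `e_j` would be a unit
      by_contra hτj
      have hu : IsUnit (τ (some j)) := (IsLocalRing.notMem_maximalIdeal).1 hτj
      have hgenj : e (some j) - (π.stalkMap ξ').hom (τ (some j)) ∈ maximalIdeal (A'.Z.presheaf.stalk ξ') := by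
        rw [← hgen]; exact Ideal.subset_span ⟨some j, by simp⟩
      exact hU0 (Finset.mem_univ j) (isUnit_of_sub_mem_maximalIdeal (hu.map (π.stalkMap ξ').hom) hgenj)
  -- the canonical index: the smallest chart containing the point
  set i₀ : Fin n := U.min' hUne with hi₀
  have hi₀U : i₀ ∈ U := Finset.min'_mem U hUne
  have hmin : ∀ l : Fin n, l < i₀ → ¬ IsUnit (e (some l)) := fun l hl hu =>
    absurd (Finset.min'_le U l (Finset.mem_filter.mpr ⟨Finset.mem_univ _, hu⟩)) (not_le.mpr (hi₀ ▸ hl))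
  -- chart data for the index `some i₀`
  obtain ⟨e', τ', he', hm', hnzd'⟩ : ∃ (e' : Option (Fin n) → A'.Z.presheaf.stalk ξ')
      (τ' : Option (Fin n) → A.Z.presheaf.stalk (π ξ')),
      (∀ j, (π.stalkMap ξ').hom (c j) = (π.stalkMap ξ').hom (c (some i₀)) * e' j) ∧
      Ideal.span (Set.range fun j : Option (Fin n) => if j = some i₀ then (π.stalkMap ξ').hom (c (some i₀))
        else e' j - (π.stalkMap ξ').hom (τ' j)) = maximalIdeal (A'.Z.presheaf.stalk ξ') ∧
      (π.stalkMap ξ').hom (c (some i₀)) ∈ nonZeroDivisors (A'.Z.presheaf.stalk ξ') := by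
    by_cases hii : i = some i₀
    · subst hii
      exact ⟨e, τ, he, hgen, hnzd⟩
    · have hu : IsUnit (e (some i₀)) := (Finset.mem_filter.mp hi₀U).2
      have hgen₀ : e (some i₀) - (π.stalkMap ξ').hom (τ (some i₀)) ∈ maximalIdeal (A'.Z.presheaf.stalk ξ') := by
        rw [← hgen]; exact Ideal.subset_span ⟨some i₀, by simp [Ne.symm hii]⟩
      have hτu : IsUnit (τ (some i₀)) := by
        by_contra h
        have h1 : (π.stalkMap ξ').hom (τ (some i₀)) ∈ maximalIdeal _ :=
          hg (Ideal.mem_map_of_mem (π.stalkMap ξ').hom ((IsLocalRing.mem_maximalIdeal _).2 h))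
        have h2 : e (some i₀) ∈ maximalIdeal _ := by
          have := add_mem hgen₀ h1; rwa [sub_add_cancel] at this
        exact (IsLocalRing.mem_maximalIdeal _).1 h2 hu
      obtain ⟨e', τ', he', -, hgen'⟩ :=
        exists_chartData_reindex (π.stalkMap ξ').hom c i e he hei τ hgen (some i₀) (Ne.symm hii) hτu
      refine ⟨e', τ', he', hgen', ?_⟩
      rw [he (some i₀)]
      exact mul_mem hnzd hu.mem_nonZeroDivisors
  -- residues of the new data at the other indices
  have hres' : ∀ j, j ≠ some i₀ → e' j - (π.stalkMap ξ').hom (τ' j) ∈ maximalIdeal (A'.Z.presheaf.stalk ξ') :=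
      fun j hj => by
    rw [← hm']; exact Ideal.subset_span ⟨j, by simp [hj]⟩
  -- canonicity: for `l < i₀` the quotient `e'_l` is not a unit, so `τ'_l ∈ 𝔪`
  have hcanon : ∀ l : Fin n, l < i₀ → τ' (some l) ∈ maximalIdeal (A.Z.presheaf.stalk (π ξ')) := by
    intro l hl
    have hli : (some l : Option (Fin n)) ≠ some i₀ := fun h => (ne_of_lt hl) (Option.some_injective _ h)
    -- `e'_l` is a unit iff `e_l` is (both are `c_l / c_•` up to units)
    have hnot : ¬ IsUnit (e' (some l)) := by
      intro hu
      apply hmin l hl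
      -- `g c_{i₀} = g cᵢ · e_{i₀}` and `g cᵢ · e_l = g c_{i₀} · e'_l = g cᵢ · e_{i₀} · e'_l`
      have h1 : (π.stalkMap ξ').hom (c i) * e (some l) = (π.stalkMap ξ').hom (c i) * (e (some i₀) * e' (some l)) := by
        rw [← he, he' (some l), he (some i₀), mul_assoc]
      have h2 : e (some l) = e (some i₀) * e' (some l) :=
        (mul_cancel_left_mem_nonZeroDivisors hnzd).mp h1
      rw [h2]
      exact (Finset.mem_filter.mp hi₀U).2.mul hu
    by_contra hτ
    have hu : IsUnit (τ' (some l)) := (IsLocalRing.notMem_maximalIdeal).1 hτ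
    exact hnot (isUnit_of_sub_mem_maximalIdeal (hu.map (π.stalkMap ξ').hom) (hres' _ hli))
  -- the transform and its presentation by the successor atom
  obtain ⟨f', hf'⟩ := exists_eq_pow_mul_of_mem_pow (π.stalkMap ξ').hom c hc (some i₀) e' he' hf₀𝔪
  have hJ' : stalkIdeal (E.transform π D).J ξ' = Ideal.span {f'} :=
    stalkIdeal_transform_eq_span hπ ξ' c hcJ (some i₀) e' he' hnzd' E f₀ hJ f' (by rw [hb]; exact hf')
  have hf'𝔪 : f' ∈ maximalIdeal (A'.Z.presheaf.stalk ξ') := by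
    have h := (mem_sing_transform_iff E ξ' f' hJ').mp hξ'
    rw [hb] at h
    exact Ideal.pow_le_self hp.ne_zero h
  obtain ⟨E', w', hw', -, hE'⟩ := exists_ringEquiv_transform_atom (π.stalkMap ξ').hom hg E₀ c hc hcX i₀ e' he' τ' hm'
    hrat hdim a hM f₀ w hw hf₀ f' hf' hf'𝔪
  -- the `z`-residue vanishes
  have hτnone : τ' none ∈ maximalIdeal (A.Z.presheaf.stalk (π ξ')) :=
    tau_none_mem_maximalIdeal_of_transform_mem (π.stalkMap ξ').hom hg E₀ c hc hcX i₀ e' he' τ' hm' hrat hdim a hord f₀ w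
      hw hf₀ f' hf' hf'𝔪
  exact ⟨i₀, e', τ', E', f', w', he', hres', hτnone, hcanon, hJ', hw', hE'⟩

/-! ## The same with the base point named -/

/-- [OURS · L1 W4.6 — DICTIONARY, canonical chart datum, base point named; NOT a statement of the manuscript] The same
statement for a point `ξ′` with `π ξ′ = ξ`, all data living at `ξ`; the structure map is
`g = π^♯_{ξ′} ∘ (𝒪_{Z,ξ} ≅ 𝒪_{Z,π ξ′})` (compatible with the canonical embeddings into `K(Z)`, brick 27
`ChartPoint.stalkEmb_stalkMap_stalkSpecializes`). [folklore] -/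
theorem exists_canonical_chartDatum_of_eq {A A' : AmbientDatum p K} (π : A'.Z ⟶ A.Z) (D : Closeds A.Z)
    (hπ : IsBlowup π (vanishingIdeal D)) (hhom : A'.hom = π ≫ A.hom) {E : IdealExponent A.Z} (hb : E.b = p)
    {ξ : A.Z} (hD : (D : Set A.Z) = {ξ})
    (hd : (maximalIdeal (A.Z.presheaf.stalk ξ)).spanFinrank = n + 1)
    (E₀ : AdicCompletion (maximalIdeal (A.Z.presheaf.stalk ξ)) (A.Z.presheaf.stalk ξ) ≃+*
      MvPowerSeries (Option (Fin n)) K)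
    (c : Option (Fin n) → A.Z.presheaf.stalk ξ)
    (hc : Ideal.span (Set.range c) = maximalIdeal (A.Z.presheaf.stalk ξ))
    (hcX : ∀ j, E₀ (algebraMap _ _ (c j)) - X j ∈ maximalIdeal (MvPowerSeries (Option (Fin n)) K) ^ 2)
    (f₀ : A.Z.presheaf.stalk ξ) (a : (Fin n → ℕ) → K) (w : MvPowerSeries (Option (Fin n)) K)
    (hJ : stalkIdeal E.J ξ = Ideal.span {f₀}) (hw : IsUnit w)
    (hf₀ : E₀ (algebraMap _ _ f₀) =
      w * ((X none : MvPowerSeries (Option (Fin n)) K) ^ p - rename (some : Fin n → Option (Fin n)) (ser p n K a)))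
    (hM : MultP p n K a) (hord : ser p n K a ∈ maximalIdeal (MvPowerSeries (Fin n) K) ^ (p + 1))
    {ξ' : A'.Z} (h : π ξ' = ξ) (hξ' : ξ' ∈ (E.transform π D).sing) (hξ'cl : IsClosed ({ξ'} : Set A'.Z)) :
    ∃ (i₀ : Fin n) (e : Option (Fin n) → A'.Z.presheaf.stalk ξ') (τ : Option (Fin n) → A.Z.presheaf.stalk ξ)
      (E₀' : AdicCompletion (maximalIdeal (A'.Z.presheaf.stalk ξ')) (A'.Z.presheaf.stalk ξ') ≃+*
        MvPowerSeries (Option (Fin n)) K)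
      (f₀' : A'.Z.presheaf.stalk ξ') (w' : MvPowerSeries (Option (Fin n)) K),
      (∀ j, (π.stalkMap ξ').hom ((A.Z.presheaf.stalkSpecializes (specializes_of_apply_eq ξ h).1).hom (c j)) =
        (π.stalkMap ξ').hom ((A.Z.presheaf.stalkSpecializes (specializes_of_apply_eq ξ h).1).hom (c (some i₀))) *
          e j) ∧
      (∀ j, j ≠ some i₀ →
        e j - (π.stalkMap ξ').hom ((A.Z.presheaf.stalkSpecializes (specializes_of_apply_eq ξ h).1).hom (τ j)) ∈
          maximalIdeal (A'.Z.presheaf.stalk ξ')) ∧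
      τ none ∈ maximalIdeal (A.Z.presheaf.stalk ξ) ∧
      (∀ l : Fin n, l < i₀ → τ (some l) ∈ maximalIdeal (A.Z.presheaf.stalk ξ)) ∧
      stalkIdeal (E.transform π D).J ξ' = Ideal.span {f₀'} ∧ IsUnit w' ∧
        E₀' (algebraMap _ _ f₀') =
          w' * ((X none : MvPowerSeries (Option (Fin n)) K) ^ p -
            rename (some : Fin n → Option (Fin n))
              (ser p n K (step p n K i₀ (fun l => constantCoeff (E₀ (algebraMap _ _ (τ (some l))))) a))) := by
  subst h
  have hsp : A.Z.presheaf.stalkSpecializes (specializes_of_apply_eq (π ξ') (rfl : π ξ' = π ξ')).1 = 𝟙 _ :=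
    TopCat.Presheaf.stalkSpecializes_refl _ _
  simp only [hsp, CommRingCat.hom_id, RingHom.id_apply]
  exact exists_canonical_chartDatum π D hπ hhom hb hD hd E₀ c hc hcX f₀ a w hJ hw hf₀ hM hord hξ' hξ'cl

end CampaignW46.ForcedAtom

end Summit.ResolutionOfSingularities.ResolutionOfSingularities.Theorems

end
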